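import Literature.Geometry.Lorentzian.CoordSigma2Linearization
import Literature.Geometry.Lorentzian.CoordCurvatureLaplacian
import Literature.Geometry.Lorentzian.CoordConjugateHeat
import HarnessLib

/-!
# Coordinate bounds feeding the Laplacian estimate of the `σ₂`-path equation

Support file for the named fact
`Literature.Geometry.Riemannian.gurskyViaclovsky_hessianEstimate_weighted_four`
(Gursky–Viaclovsky 2003, Prop. 6; S. Chen 2005, Thm. 1(a)). The maximum-point estimate
`MetricCoord.IsMetricOn.normSqAt_hessAt_le_of_isLocalMax_of_norm`
(`CoordSigma2LaplacianEstimate.lean`) asks for multilinear norm bounds on `Rm`, `∇Rm`, `∇B`,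
`∇²B`, a norm bound on the orthonormal frame, and bounds on `dΦ`, `ΔΦ` for the right-hand side
`Φ = (1/16)|W_g|² + (q/4)e^{4u}` of the path equation. This file derives all of them from
operator norms of the smooth coordinate fields (so that continuity and compactness make them
uniform), in the coordinate language of `CoordCurvature.lean`:

* `sq_apply_le_mul_apply_self`, `norm_le_of_apply_self_eq_one` — Cauchy–Schwarz for a positive
  semidefinite `G x` and the bound `‖v‖ ≤ ‖(G x)⁻¹‖ (1 + ‖G x‖)/2` for `G x`-unit vectors;
* `abs_fderiv_le_of_gradSqAt_le` — `|df(X)| ≤ n ‖G x‖ κ (1 + |∇f|²)/2 · ‖X‖`;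
* `abs_apply_riemAt_le`, `IsMetricOn.abs_apply_covRiemAt_le`, `abs_cov₃At_le` — entries of
  `Rm`, `∇Rm`, `∇²B` against operator norms of `G`, `riemCLM`, `D riemCLM`, `Γ`, `∇B`, `D∇B`;
* `mtrAt_schouten` — `tr_G W = Δf + (1 − n/2)|∇f|² + tr_G B` for
  `W = Hess f + df⊗df − ½|∇f|²G + B`;
* `sigma2Path_frame_algebra` — the polynomial identity turning the frame form of the path
  equation into `½(c (tr W)² − |W|²) = (1/16)|W_g|² + (q/4)e^{4u}`;
* `fderiv_rhs_apply`, `lapAt_rhs`, `abs_fderiv_rhs_le`, `abs_lapAt_rhs_le` — the derivative and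
  the Laplacian of `Φ = a ω + b q e^{4f}` and their bounds `|dΦ(X)| ≤ K‖X‖`,
  `|ΔΦ| ≤ K(1 + |Δf|)` from bounds on `ω, q` (two derivatives), `|f|`, `|∇f|²`, `|df|`.

Everything is proved; no definition and no named fact is introduced.

## References

* S. Chen, *Local estimates for some fully nonlinear elliptic equations*, IMRN 2005:63, Thm. 1(a)
  (the constant `c_sup` and the dependence on `‖g‖_{C³}`, `‖B‖_{C²}`), §3. [Chen2005]
* M. J. Gursky, J. A. Viaclovsky, J. Differential Geom. 63 (2003) 131–154, Prop. 6.
  [GurskyViaclovsky2003]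
* B. O'Neill, *Semi-Riemannian geometry*, Academic Press 1983, Ch. 3, pp. 60–61, 85. [ONeill1983]
-/

noncomputable section

set_option maxSynthPendingDepth 3

open Set Filter ContinuousLinearMap Module Finset
open scoped Topology ContDiff

namespace Literature.Geometry.Lorentzian

namespace MetricCoord

variable {E : Type*} [NormedAddCommGroup E] [NormedSpace ℝ E]
  {G : E → E →L[ℝ] E →L[ℝ] ℝ} {V : Set E} {x : E}

/-! ### Cauchy–Schwarz and the norm of unit vectors -/

/-- **Cauchy–Schwarz for a symmetric positive semidefinite `G x`**: `G(v,w)² ≤ G(v,v) G(w,w)`.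
[folklore] -/
theorem sq_apply_le_mul_apply_self (hs : ∀ v w, G x v w = G x w v) (hnn : ∀ v, 0 ≤ G x v v)
    (v w : E) : G x v w ^ 2 ≤ G x v v * G x w w := by
  have h : ∀ t : ℝ, 0 ≤ G x w w * (t * t) + 2 * G x v w * t + G x v v := by
    intro t
    have h1 := hnn (v + t • w)
    simp only [map_add, map_smul, _root_.add_apply, _root_.smul_apply, smul_eq_mul] at h1
    rw [hs w v] at h1
    nlinarith [h1]
  have hd := discrim_le_zero h
  rw [discrim] at hd
  nlinarith [hd]

/-- **Norm of a `G x`-unit vector**: if `G x` is invertible, symmetric and positive semidefinite and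
`G(v,v) = 1`, then `‖v‖ ≤ ‖(G x)⁻¹‖ (1 + ‖G x‖)/2` (`v = ♯(G v)`, `‖G v‖ ≤ ‖G x‖^{1/2}` by
Cauchy–Schwarz, `√a ≤ (1 + a)/2`). [folklore] -/
theorem norm_le_of_apply_self_eq_one (hi : (G x).IsInvertible) (hs : ∀ v w, G x v w = G x w v)
    (hnn : ∀ v, 0 ≤ G x v v) {v : E} (hv : G x v v = 1) :
    ‖v‖ ≤ ‖sharpAt G x‖ * ((1 + ‖G x‖) / 2) := by
  have h1 : ‖G x v‖ ≤ (1 + ‖G x‖) / 2 := by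
    refine ContinuousLinearMap.opNorm_le_bound _ (by positivity) fun w ↦ ?_
    have hcs := sq_apply_le_mul_apply_self hs hnn v w
    rw [hv, one_mul] at hcs
    have hw : G x w w ≤ ‖G x‖ * ‖w‖ ^ 2 := by
      calc G x w w ≤ ‖G x w w‖ := Real.le_norm_self _
        _ ≤ ‖G x‖ * ‖w‖ * ‖w‖ := (G x).le_opNorm₂ w w
        _ = ‖G x‖ * ‖w‖ ^ 2 := by ring
    have h2 : (G x v w) ^ 2 ≤ (((1 + ‖G x‖) / 2) * ‖w‖) ^ 2 := by
      calc (G x v w) ^ 2 ≤ G x w w := hcs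
        _ ≤ ‖G x‖ * ‖w‖ ^ 2 := hw
        _ ≤ (((1 + ‖G x‖) / 2) * ‖w‖) ^ 2 := by
            nlinarith [sq_nonneg (1 - ‖G x‖), sq_nonneg ‖w‖, norm_nonneg (G x)]
    have habs : |G x v w| ≤ ((1 + ‖G x‖) / 2) * ‖w‖ := abs_le.2 (abs_le_of_sq_le_sq' h2 (by positivity))
    rw [Real.norm_eq_abs]
    exact habs
  calc ‖v‖ = ‖sharpAt G x (G x v)‖ := by rw [sharpAt_apply hi]
    _ ≤ ‖sharpAt G x‖ * ‖G x v‖ := (sharpAt G x).le_opNorm _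
    _ ≤ ‖sharpAt G x‖ * ((1 + ‖G x‖) / 2) := mul_le_mul_of_nonneg_left h1 (norm_nonneg _)

variable {ι : Type*} [Fintype ι] [DecidableEq ι]

/-- **`|df(X)| ≤ n ‖G x‖ κ (1 + |∇f|²)/2 ‖X‖`** in terms of a `G x`-orthonormal basis with
`‖e_a‖ ≤ κ`: expand `X = Σ G(X,e_a) e_a`, `|df(e_a)| ≤ (1 + df(e_a)²)/2 ≤ (1 + |∇f|²)/2`.
[cite: ONeill1983, Ch. 3, p. 85] -/
theorem abs_fderiv_le_of_gradSqAt_le (e : Basis ι ℝ E)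
    (he : ∀ i j, G x (e i) (e j) = if i = j then 1 else 0) (hi : (G x).IsInvertible)
    (hs : ∀ v w, G x v w = G x w v) {f : E → ℝ} {κ γ : ℝ} (hκ : 0 ≤ κ) (heκ : ∀ a, ‖e a‖ ≤ κ)
    (hγ : gradSqAt G f x ≤ γ) (X : E) :
    |fderiv ℝ f x X| ≤ Fintype.card ι * (‖G x‖ * κ * ((1 + γ) / 2)) * ‖X‖ := by
  have hexp : fderiv ℝ f x X = ∑ a, G x X (e a) * fderiv ℝ f x (e a) := by
    conv_lhs => rw [← sum_apply_smul_of_orthonormal e he X]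
    rw [map_sum]
    exact Finset.sum_congr rfl fun a _ ↦ by rw [map_smul, smul_eq_mul]
  have hd : ∀ a, |fderiv ℝ f x (e a)| ≤ (1 + γ) / 2 := by
    intro a
    have h1 : fderiv ℝ f x (e a) ^ 2 ≤ gradSqAt G f x := by
      rw [gradSqAt_eq_sum_frame e he hi hs f]
      exact Finset.single_le_sum (f := fun c ↦ fderiv ℝ f x (e c) ^ 2) (fun _ _ ↦ sq_nonneg _)
        (Finset.mem_univ a)
    have h2 : |fderiv ℝ f x (e a)| ≤ (1 + fderiv ℝ f x (e a) ^ 2) / 2 := by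
      have := sq_nonneg (|fderiv ℝ f x (e a)| - 1)
      rw [← sq_abs] ; nlinarith [abs_nonneg (fderiv ℝ f x (e a))]
    linarith
  have hent : ∀ a, |G x X (e a) * fderiv ℝ f x (e a)| ≤ ‖G x‖ * κ * ((1 + γ) / 2) * ‖X‖ := by
    intro a
    rw [abs_mul]
    have h1 : |G x X (e a)| ≤ ‖G x‖ * ‖X‖ * κ :=
      (Real.norm_eq_abs _ ▸ (G x).le_opNorm₂ X (e a)).trans
        (mul_le_mul_of_nonneg_left (heκ a) (by positivity))
    have h2 := hd a
    have h3 : 0 ≤ (1 + γ) / 2 := le_trans (abs_nonneg _) h2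
    calc |G x X (e a)| * |fderiv ℝ f x (e a)| ≤ ‖G x‖ * ‖X‖ * κ * ((1 + γ) / 2) :=
          mul_le_mul h1 h2 (abs_nonneg _) (by positivity)
      _ = ‖G x‖ * κ * ((1 + γ) / 2) * ‖X‖ := by ring
  rw [hexp]
  refine (Finset.abs_sum_le_sum_abs _ _).trans ?_
  calc ∑ a, |G x X (e a) * fderiv ℝ f x (e a)| ≤ ∑ _a : ι, ‖G x‖ * κ * ((1 + γ) / 2) * ‖X‖ :=
        Finset.sum_le_sum fun a _ ↦ hent a
    _ = Fintype.card ι * (‖G x‖ * κ * ((1 + γ) / 2)) * ‖X‖ := by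
        rw [Finset.sum_const, Finset.card_univ, nsmul_eq_mul]; ring

/-! ### Entries of `Rm`, `∇Rm`, `∇²B` against operator norms -/

/-- **`|G(R(X,Y)U, U')| ≤ ‖G x‖ ‖riemCLM G x‖ ‖X‖ ‖Y‖ ‖U‖ ‖U'‖`.** [cite: ONeill1983, Ch. 3, Lemma 3.38] -/
theorem abs_apply_riemAt_le (X Y U U' : E) :
    |G x (riemAt G x X Y U) U'| ≤ ‖G x‖ * ‖riemCLM G x‖ * ‖X‖ * ‖Y‖ * ‖U‖ * ‖U'‖ := by
  rw [← riemCLM_apply G x X Y, ← Real.norm_eq_abs]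
  calc ‖G x (riemCLM G x X Y U) U'‖ ≤ ‖G x‖ * ‖riemCLM G x X Y U‖ * ‖U'‖ := (G x).le_opNorm₂ _ _
    _ ≤ ‖G x‖ * (‖riemCLM G x‖ * ‖X‖ * ‖Y‖ * ‖U‖) * ‖U'‖ := by
        gcongr
        calc ‖riemCLM G x X Y U‖ ≤ ‖riemCLM G x X Y‖ * ‖U‖ := (riemCLM G x X Y).le_opNorm U
          _ ≤ ‖riemCLM G x X‖ * ‖Y‖ * ‖U‖ := by gcongr; exact (riemCLM G x X).le_opNorm Y
          _ ≤ ‖riemCLM G x‖ * ‖X‖ * ‖Y‖ * ‖U‖ := by gcongr; exact (riemCLM G x).le_opNorm X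
    _ = ‖G x‖ * ‖riemCLM G x‖ * ‖X‖ * ‖Y‖ * ‖U‖ * ‖U'‖ := by ring

variable [CompleteSpace E]

/-- **`|G((∇_X R)(Y,U)U', U'')| ≤ ‖G x‖ (‖D riemCLM(x)‖ + 4‖Γ_x‖ ‖riemCLM G x‖) ‖X‖‖Y‖‖U‖‖U'‖‖U''‖`**
on `V` (`covRiemCLM_apply'`). [cite: ONeill1983, Ch. 3, Prop. 3.37] -/
theorem IsMetricOn.abs_apply_covRiemAt_le (hG : IsMetricOn G V) (hx : x ∈ V) (X Y U U' U'' : E) :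
    |G x (covRiemAt G x X Y U U') U''| ≤
      ‖G x‖ * (‖fderiv ℝ (riemCLM G) x‖ + 4 * ‖chrAt G x‖ * ‖riemCLM G x‖)
        * ‖X‖ * ‖Y‖ * ‖U‖ * ‖U'‖ * ‖U''‖ := by
  have hR : ∀ A B C : E, ‖riemCLM G x A B C‖ ≤ ‖riemCLM G x‖ * ‖A‖ * ‖B‖ * ‖C‖ := by
    intro A B C
    calc ‖riemCLM G x A B C‖ ≤ ‖riemCLM G x A B‖ * ‖C‖ := (riemCLM G x A B).le_opNorm C
      _ ≤ ‖riemCLM G x A‖ * ‖B‖ * ‖C‖ := by gcongr; exact (riemCLM G x A).le_opNorm B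
      _ ≤ ‖riemCLM G x‖ * ‖A‖ * ‖B‖ * ‖C‖ := by gcongr; exact (riemCLM G x).le_opNorm A
  have hΓ : ∀ A B : E, ‖chrAt G x A B‖ ≤ ‖chrAt G x‖ * ‖A‖ * ‖B‖ := fun A B ↦ (chrAt G x).le_opNorm₂ A B
  have hcov : covRiemAt G x X Y U U' = covRiemCLM G x Y X U U' := by
    rw [hG.covRiemCLM_apply hx Y X U]
  have h1 : ‖fderiv ℝ (riemCLM G) x X Y U U'‖ ≤ ‖fderiv ℝ (riemCLM G) x‖ * ‖X‖ * ‖Y‖ * ‖U‖ * ‖U'‖ := by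
    calc ‖fderiv ℝ (riemCLM G) x X Y U U'‖ ≤ ‖fderiv ℝ (riemCLM G) x X Y U‖ * ‖U'‖ :=
          (fderiv ℝ (riemCLM G) x X Y U).le_opNorm U'
      _ ≤ ‖fderiv ℝ (riemCLM G) x X Y‖ * ‖U‖ * ‖U'‖ := by
          gcongr; exact (fderiv ℝ (riemCLM G) x X Y).le_opNorm U
      _ ≤ ‖fderiv ℝ (riemCLM G) x X‖ * ‖Y‖ * ‖U‖ * ‖U'‖ := by
          gcongr; exact (fderiv ℝ (riemCLM G) x X).le_opNorm Y
      _ ≤ ‖fderiv ℝ (riemCLM G) x‖ * ‖X‖ * ‖Y‖ * ‖U‖ * ‖U'‖ := by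
          gcongr; exact (fderiv ℝ (riemCLM G) x).le_opNorm X
  have h2 : ‖(chrAt G x X).comp (riemCLM G x Y U) U'‖ ≤
      ‖chrAt G x‖ * ‖riemCLM G x‖ * ‖X‖ * ‖Y‖ * ‖U‖ * ‖U'‖ := by
    rw [ContinuousLinearMap.comp_apply]
    calc ‖chrAt G x X (riemCLM G x Y U U')‖ ≤ ‖chrAt G x‖ * ‖X‖ * ‖riemCLM G x Y U U'‖ := hΓ _ _
      _ ≤ ‖chrAt G x‖ * ‖X‖ * (‖riemCLM G x‖ * ‖Y‖ * ‖U‖ * ‖U'‖) := by gcongr; exact hR _ _ _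
      _ = _ := by ring
  have h3 : ‖(riemCLM G x Y U).comp (chrAt G x X) U'‖ ≤
      ‖chrAt G x‖ * ‖riemCLM G x‖ * ‖X‖ * ‖Y‖ * ‖U‖ * ‖U'‖ := by
    rw [ContinuousLinearMap.comp_apply]
    calc ‖riemCLM G x Y U (chrAt G x X U')‖ ≤ ‖riemCLM G x‖ * ‖Y‖ * ‖U‖ * ‖chrAt G x X U'‖ := hR _ _ _
      _ ≤ ‖riemCLM G x‖ * ‖Y‖ * ‖U‖ * (‖chrAt G x‖ * ‖X‖ * ‖U'‖) := by gcongr; exact hΓ _ _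
      _ = _ := by ring
  have h4 : ‖riemCLM G x (chrAt G x X Y) U U'‖ ≤
      ‖chrAt G x‖ * ‖riemCLM G x‖ * ‖X‖ * ‖Y‖ * ‖U‖ * ‖U'‖ := by
    calc ‖riemCLM G x (chrAt G x X Y) U U'‖ ≤ ‖riemCLM G x‖ * ‖chrAt G x X Y‖ * ‖U‖ * ‖U'‖ := hR _ _ _
      _ ≤ ‖riemCLM G x‖ * (‖chrAt G x‖ * ‖X‖ * ‖Y‖) * ‖U‖ * ‖U'‖ := by gcongr; exact hΓ _ _
      _ = _ := by ring
  have h5 : ‖riemCLM G x Y (chrAt G x X U) U'‖ ≤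
      ‖chrAt G x‖ * ‖riemCLM G x‖ * ‖X‖ * ‖Y‖ * ‖U‖ * ‖U'‖ := by
    calc ‖riemCLM G x Y (chrAt G x X U) U'‖ ≤ ‖riemCLM G x‖ * ‖Y‖ * ‖chrAt G x X U‖ * ‖U'‖ := hR _ _ _
      _ ≤ ‖riemCLM G x‖ * ‖Y‖ * (‖chrAt G x‖ * ‖X‖ * ‖U‖) * ‖U'‖ := by gcongr; exact hΓ _ _
      _ = _ := by ring
  have hv : ‖covRiemAt G x X Y U U'‖ ≤
      (‖fderiv ℝ (riemCLM G) x‖ + 4 * ‖chrAt G x‖ * ‖riemCLM G x‖) * ‖X‖ * ‖Y‖ * ‖U‖ * ‖U'‖ := by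
    rw [hcov, covRiemCLM_apply']
    have := norm_sub_le (fderiv ℝ (riemCLM G) x X Y U U' + (chrAt G x X).comp (riemCLM G x Y U) U'
      - (riemCLM G x Y U).comp (chrAt G x X) U' - riemCLM G x (chrAt G x X Y) U U')
      (riemCLM G x Y (chrAt G x X U) U')
    have := norm_sub_le (fderiv ℝ (riemCLM G) x X Y U U' + (chrAt G x X).comp (riemCLM G x Y U) U'
      - (riemCLM G x Y U).comp (chrAt G x X) U') (riemCLM G x (chrAt G x X Y) U U')
    have := norm_sub_le (fderiv ℝ (riemCLM G) x X Y U U' + (chrAt G x X).comp (riemCLM G x Y U) U')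
      ((riemCLM G x Y U).comp (chrAt G x X) U')
    have := norm_add_le (fderiv ℝ (riemCLM G) x X Y U U') ((chrAt G x X).comp (riemCLM G x Y U) U')
    simp only [_root_.sub_apply, _root_.add_apply] at *
    nlinarith [h1, h2, h3, h4, h5, norm_nonneg X, norm_nonneg Y, norm_nonneg U, norm_nonneg U']
  rw [← Real.norm_eq_abs]
  calc ‖G x (covRiemAt G x X Y U U') U''‖ ≤ ‖G x‖ * ‖covRiemAt G x X Y U U'‖ * ‖U''‖ :=
        (G x).le_opNorm₂ _ _
    _ ≤ ‖G x‖ * ((‖fderiv ℝ (riemCLM G) x‖ + 4 * ‖chrAt G x‖ * ‖riemCLM G x‖)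
          * ‖X‖ * ‖Y‖ * ‖U‖ * ‖U'‖) * ‖U''‖ := by gcongr
    _ = _ := by ring

omit [CompleteSpace E] in
/-- **`|∇²_{W,A} τ (B, C)| ≤ (‖Dτ(x)‖ + 3‖τ x‖ ‖Γ_x‖) ‖W‖‖A‖‖B‖‖C‖`** for a field of `3`-slot forms
(`cov₃At_apply`). [cite: ONeill1983, Ch. 2, Prop. 2.13] -/
theorem abs_cov₃At_le (τ : E → E →L[ℝ] E →L[ℝ] E →L[ℝ] ℝ) (W A B C : E) :
    |cov₃At G τ x W A B C| ≤
      (‖fderiv ℝ τ x‖ + 3 * ‖τ x‖ * ‖chrAt G x‖) * ‖W‖ * ‖A‖ * ‖B‖ * ‖C‖ := by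
  have hτ : ∀ P Q R : E, |τ x P Q R| ≤ ‖τ x‖ * ‖P‖ * ‖Q‖ * ‖R‖ := by
    intro P Q R
    rw [← Real.norm_eq_abs]
    calc ‖τ x P Q R‖ ≤ ‖τ x P Q‖ * ‖R‖ := (τ x P Q).le_opNorm R
      _ ≤ ‖τ x P‖ * ‖Q‖ * ‖R‖ := by gcongr; exact (τ x P).le_opNorm Q
      _ ≤ ‖τ x‖ * ‖P‖ * ‖Q‖ * ‖R‖ := by gcongr; exact (τ x).le_opNorm P
  have hΓ : ∀ P Q : E, ‖chrAt G x P Q‖ ≤ ‖chrAt G x‖ * ‖P‖ * ‖Q‖ := fun P Q ↦ (chrAt G x).le_opNorm₂ P Q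
  have h0 : |fderiv ℝ τ x W A B C| ≤ ‖fderiv ℝ τ x‖ * ‖W‖ * ‖A‖ * ‖B‖ * ‖C‖ := by
    rw [← Real.norm_eq_abs]
    calc ‖fderiv ℝ τ x W A B C‖ ≤ ‖fderiv ℝ τ x W A B‖ * ‖C‖ := (fderiv ℝ τ x W A B).le_opNorm C
      _ ≤ ‖fderiv ℝ τ x W A‖ * ‖B‖ * ‖C‖ := by gcongr; exact (fderiv ℝ τ x W A).le_opNorm B
      _ ≤ ‖fderiv ℝ τ x W‖ * ‖A‖ * ‖B‖ * ‖C‖ := by gcongr; exact (fderiv ℝ τ x W).le_opNorm A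
      _ ≤ ‖fderiv ℝ τ x‖ * ‖W‖ * ‖A‖ * ‖B‖ * ‖C‖ := by gcongr; exact (fderiv ℝ τ x).le_opNorm W
  have h1 : |τ x (chrAt G x W A) B C| ≤ ‖τ x‖ * ‖chrAt G x‖ * ‖W‖ * ‖A‖ * ‖B‖ * ‖C‖ := by
    calc |τ x (chrAt G x W A) B C| ≤ ‖τ x‖ * ‖chrAt G x W A‖ * ‖B‖ * ‖C‖ := hτ _ _ _
      _ ≤ ‖τ x‖ * (‖chrAt G x‖ * ‖W‖ * ‖A‖) * ‖B‖ * ‖C‖ := by gcongr; exact hΓ _ _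
      _ = _ := by ring
  have h2 : |τ x A (chrAt G x W B) C| ≤ ‖τ x‖ * ‖chrAt G x‖ * ‖W‖ * ‖A‖ * ‖B‖ * ‖C‖ := by
    calc |τ x A (chrAt G x W B) C| ≤ ‖τ x‖ * ‖A‖ * ‖chrAt G x W B‖ * ‖C‖ := hτ _ _ _
      _ ≤ ‖τ x‖ * ‖A‖ * (‖chrAt G x‖ * ‖W‖ * ‖B‖) * ‖C‖ := by gcongr; exact hΓ _ _
      _ = _ := by ring
  have h3 : |τ x A B (chrAt G x W C)| ≤ ‖τ x‖ * ‖chrAt G x‖ * ‖W‖ * ‖A‖ * ‖B‖ * ‖C‖ := by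
    calc |τ x A B (chrAt G x W C)| ≤ ‖τ x‖ * ‖A‖ * ‖B‖ * ‖chrAt G x W C‖ := hτ _ _ _
      _ ≤ ‖τ x‖ * ‖A‖ * ‖B‖ * (‖chrAt G x‖ * ‖W‖ * ‖C‖) := by gcongr; exact hΓ _ _
      _ = _ := by ring
  rw [cov₃At_apply]
  have := abs_sub (fderiv ℝ τ x W A B C - τ x (chrAt G x W A) B C - τ x A (chrAt G x W B) C)
    (τ x A B (chrAt G x W C))
  have := abs_sub (fderiv ℝ τ x W A B C - τ x (chrAt G x W A) B C) (τ x A (chrAt G x W B) C)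
  have := abs_sub (fderiv ℝ τ x W A B C) (τ x (chrAt G x W A) B C)
  nlinarith [h0, h1, h2, h3, norm_nonneg W, norm_nonneg A, norm_nonneg B, norm_nonneg C]


/-! ### The trace of the Schouten-type field -/

omit [CompleteSpace E] in
/-- **`tr_G W = Δf + (1 − n/2)|∇f|² + tr_G B`** for `W = Hess f + df⊗df − ½|∇f|²G + B`
(`tr Hess = Δ`, `tr df⊗df = |∇f|²`, `tr G = n`). [cite: Chen2005, §3] -/
theorem mtrAt_schouten [FiniteDimensional ℝ E] (hi : (G x).IsInvertible) {f : E → ℝ}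
    {Bf W : E → E →L[ℝ] E →L[ℝ] ℝ}
    (hW : W = (fun y ↦ hessAt G f y
      + ContinuousLinearMap.smulRightL ℝ E (E →L[ℝ] ℝ) (fderiv ℝ f y) (fderiv ℝ f y)
      - (1 / 2 : ℝ) • (gradSqAt G f y • G y) + Bf y)) :
    mtrAt G x (W x) = lapAt G f x + (1 - (finrank ℝ E : ℝ) / 2) * gradSqAt G f x
      + mtrAt G x (Bf x) := by
  have hdd : ContinuousLinearMap.smulRightL ℝ E (E →L[ℝ] ℝ) (fderiv ℝ f x) (fderiv ℝ f x) =
      (fderiv ℝ f x).smulRight (fderiv ℝ f x) := by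
    ext v w
    simp
  rw [hW]
  simp only
  rw [mtrAt_add, mtrAt_sub, mtrAt_add, mtrAt_smul, mtrAt_smul, mtrAt_self hi, hdd, mtrAt_smulRight,
    ← gradSqAt_apply, ← lapAt]
  ring

/-! ### The right-hand side `Φ = a ω + b q e^{4f}`: derivative, Laplacian, bounds -/

section Rhs

variable {wf q f : E → ℝ}

omit [CompleteSpace E] in
/-- The derivative of `z ↦ e^{4 f z}`. [folklore] -/
theorem hasFDerivAt_exp_four_mul (hf : DifferentiableAt ℝ f x) :
    HasFDerivAt (fun z ↦ Real.exp (4 * f z)) ((4 * Real.exp (4 * f x)) • fderiv ℝ f x) x := by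
  have h := (hf.hasFDerivAt.const_mul (4 : ℝ)).exp
  convert h using 1
  rw [smul_smul, mul_comm]

omit [CompleteSpace E] in
/-- **`dΦ(X)` for `Φ = a ω + b q e^{4f}`**: `a dω(X) + b (dq(X) e^{4f} + 4 q e^{4f} df(X))`.
[cite: Chen2005, Thm. 1 (the constant `c_sup`)] -/
theorem fderiv_rhs_apply (hω : DifferentiableAt ℝ wf x) (hq : DifferentiableAt ℝ q x)
    (hf : DifferentiableAt ℝ f x) (a b : ℝ) (X : E) :
    fderiv ℝ (fun z ↦ a * wf z + b * (q z * Real.exp (4 * f z))) x X =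
      a * fderiv ℝ wf x X + b * (fderiv ℝ q x X * Real.exp (4 * f x)
        + q x * (4 * Real.exp (4 * f x) * fderiv ℝ f x X)) := by
  have he := hasFDerivAt_exp_four_mul hf
  have h := (hω.hasFDerivAt.const_mul a).fun_add ((hq.hasFDerivAt.fun_mul he).const_mul b)
  rw [h.fderiv]
  simp only [_root_.add_apply, FunLike.coe_smul, Pi.smul_apply, smul_eq_mul]
  ring

variable [FiniteDimensional ℝ E]

omit [CompleteSpace E] in
/-- **`Δ e^{4f} = e^{4f}(4 Δf + 16 |∇f|²)`.** [cite: ONeill1983, Ch. 3, Def. 3.50] -/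
theorem lapAt_exp_four_mul (hf : ContDiffAt ℝ 2 f x) :
    lapAt G (fun z ↦ Real.exp (4 * f z)) x =
      Real.exp (4 * f x) * (4 * lapAt G f x + 16 * gradSqAt G f x) := by
  have hg : ContDiffAt ℝ 2 (fun s : ℝ ↦ Real.exp (4 * s)) (f x) :=
    (Real.contDiff_exp.comp (contDiff_const.mul contDiff_id)).contDiffAt
  have hD : ∀ s : ℝ, HasDerivAt (fun s : ℝ ↦ Real.exp (4 * s)) (Real.exp (4 * s) * 4) s := by
    intro s
    have := ((hasDerivAt_id s).const_mul (4 : ℝ)).exp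
    simpa using this
  have hd1 : deriv (fun s : ℝ ↦ Real.exp (4 * s)) = fun s ↦ 4 * Real.exp (4 * s) := by
    funext s
    rw [(hD s).deriv]; ring
  have hd2 : deriv (deriv (fun s : ℝ ↦ Real.exp (4 * s))) = fun s ↦ 16 * Real.exp (4 * s) := by
    rw [hd1]
    funext s
    rw [((hD s).const_mul (4 : ℝ)).deriv]; ring
  rw [lapAt_comp_of_contDiffAt (G := G) hg hf, hd2, hd1]
  ring

omit [CompleteSpace E] in
/-- **`ΔΦ` for `Φ = a ω + b q e^{4f}`**:
`a Δω + b (q e^{4f}(4Δf + 16|∇f|²) + e^{4f} Δq + 8 e^{4f} dq(♯df))` (product and chain rules).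
[cite: Chen2005, Thm. 1 (the constant `c_sup`)] -/
theorem lapAt_rhs (hi : (G x).IsInvertible) (hs : ∀ v w, G x v w = G x w v)
    (hω : ContDiffAt ℝ 2 wf x) (hq : ContDiffAt ℝ 2 q x) (hf : ContDiffAt ℝ 2 f x) (a b : ℝ) :
    lapAt G (fun z ↦ a * wf z + b * (q z * Real.exp (4 * f z))) x =
      a * lapAt G wf x + b * (q x * (Real.exp (4 * f x) * (4 * lapAt G f x + 16 * gradSqAt G f x))
        + Real.exp (4 * f x) * lapAt G q x
        + 2 * fderiv ℝ q x (sharpAt G x ((4 * Real.exp (4 * f x)) • fderiv ℝ f x))) := by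
  have he : ContDiffAt ℝ 2 (fun z ↦ Real.exp (4 * f z)) x :=
    Real.contDiff_exp.contDiffAt.comp x (contDiffAt_const.mul hf)
  have hqe : ContDiffAt ℝ 2 (fun z ↦ q z * Real.exp (4 * f z)) x := hq.mul he
  have h1 : ContDiffAt ℝ 2 (fun z ↦ a * wf z) x := contDiffAt_const.mul hω
  have h2 : ContDiffAt ℝ 2 (fun z ↦ b * (q z * Real.exp (4 * f z))) x := contDiffAt_const.mul hqe
  rw [lapAt_add G h1 h2, lapAt_const_mul G hω, lapAt_const_mul G hqe, lapAt_mul G hi hs hq he,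
    lapAt_exp_four_mul hf, (hasFDerivAt_exp_four_mul (hf.differentiableAt (by norm_num))).fderiv]

omit [NormedAddCommGroup E] [NormedSpace ℝ E] [CompleteSpace E] [FiniteDimensional ℝ E] in
/-- **Lower bound for the right-hand side**: `Φ ≥ b q e^{4f} ≥ b q₀ e^{−4C₀}` when `a ω ≥ 0`,
`b ≥ 0`, `q ≥ q₀ ≥ 0`, `|f| ≤ C₀`. [cite: GurskyViaclovsky2003, §1 (PDE)] -/
theorem rhs_ge (a b : ℝ) (hb : 0 ≤ b) (hω : 0 ≤ a * wf x) {q₀ C₀ : ℝ} (hq₀ : 0 ≤ q₀)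
    (hq : q₀ ≤ q x) (hf : |f x| ≤ C₀) :
    b * q₀ * Real.exp (-(4 * C₀)) ≤ a * wf x + b * (q x * Real.exp (4 * f x)) := by
  have h1 : Real.exp (-(4 * C₀)) ≤ Real.exp (4 * f x) :=
    Real.exp_le_exp.2 (by linarith [(abs_le.1 hf).1])
  have h2 : b * q₀ * Real.exp (-(4 * C₀)) ≤ b * (q x * Real.exp (4 * f x)) := by
    rw [mul_assoc]
    exact mul_le_mul_of_nonneg_left
      (mul_le_mul hq h1 (Real.exp_pos _).le (hq₀.trans hq)) hb
  linarith

omit [CompleteSpace E] [FiniteDimensional ℝ E] in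
/-- **`|dΦ(X)| ≤ (|a| K_ω + |b| K_q e^{4C₀} (1 + 4 K_d)) ‖X‖`** for `Φ = a ω + b q e^{4f}`, given
`‖dω‖ ≤ K_ω`, `|q|, ‖dq‖ ≤ K_q`, `|f| ≤ C₀`, `|df(X)| ≤ K_d ‖X‖`.
[cite: Chen2005, Thm. 1 (the constant `c_sup`)] -/
theorem abs_fderiv_rhs_le (hω : DifferentiableAt ℝ wf x) (hq : DifferentiableAt ℝ q x)
    (hf : DifferentiableAt ℝ f x) (a b : ℝ) {Kω Kq C₀ Kd : ℝ}
    (hω1 : ‖fderiv ℝ wf x‖ ≤ Kω) (hq0 : |q x| ≤ Kq) (hq1 : ‖fderiv ℝ q x‖ ≤ Kq) (hf0 : |f x| ≤ C₀)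
    (hDf : ∀ X, |fderiv ℝ f x X| ≤ Kd * ‖X‖) (X : E) :
    |fderiv ℝ (fun z ↦ a * wf z + b * (q z * Real.exp (4 * f z))) x X| ≤
      (|a| * Kω + |b| * Kq * Real.exp (4 * C₀) * (1 + 4 * Kd)) * ‖X‖ := by
  rw [fderiv_rhs_apply hω hq hf a b X]
  have hKq : 0 ≤ Kq := (abs_nonneg _).trans hq0
  have he0 : 0 < Real.exp (4 * f x) := Real.exp_pos _
  have he : Real.exp (4 * f x) ≤ Real.exp (4 * C₀) :=
    Real.exp_le_exp.2 (by linarith [(abs_le.1 hf0).2])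
  have h1 : |fderiv ℝ wf x X| ≤ Kω * ‖X‖ :=
    (Real.norm_eq_abs _ ▸ (fderiv ℝ wf x).le_opNorm X).trans (mul_le_mul_of_nonneg_right hω1 (norm_nonneg _))
  have h2 : |fderiv ℝ q x X| ≤ Kq * ‖X‖ :=
    (Real.norm_eq_abs _ ▸ (fderiv ℝ q x).le_opNorm X).trans (mul_le_mul_of_nonneg_right hq1 (norm_nonneg _))
  have h3 := hDf X
  have hA : |fderiv ℝ q x X * Real.exp (4 * f x)| ≤ Kq * Real.exp (4 * C₀) * ‖X‖ := by
    rw [abs_mul, abs_of_pos he0]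
    calc |fderiv ℝ q x X| * Real.exp (4 * f x) ≤ Kq * ‖X‖ * Real.exp (4 * C₀) :=
          mul_le_mul h2 he he0.le (by positivity)
      _ = _ := by ring
  have hB : |q x * (4 * Real.exp (4 * f x) * fderiv ℝ f x X)| ≤ Kq * Real.exp (4 * C₀) * (4 * Kd) * ‖X‖ := by
    rw [abs_mul, abs_mul, abs_mul, abs_of_pos he0, abs_of_pos (by norm_num : (0:ℝ) < 4)]
    calc |q x| * (4 * Real.exp (4 * f x) * |fderiv ℝ f x X|)
        ≤ Kq * (4 * Real.exp (4 * C₀) * (Kd * ‖X‖)) := by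
          refine mul_le_mul hq0 ?_ (by positivity) hKq
          exact mul_le_mul (mul_le_mul_of_nonneg_left he (by norm_num)) h3 (abs_nonneg _) (by positivity)
      _ = _ := by ring
  calc |a * fderiv ℝ wf x X + b * (fderiv ℝ q x X * Real.exp (4 * f x)
        + q x * (4 * Real.exp (4 * f x) * fderiv ℝ f x X))|
      ≤ |a| * |fderiv ℝ wf x X| + |b| * (|fderiv ℝ q x X * Real.exp (4 * f x)|
        + |q x * (4 * Real.exp (4 * f x) * fderiv ℝ f x X)|) := by
        refine (abs_add_le _ _).trans ?_
        rw [abs_mul, abs_mul]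
        gcongr
        exact abs_add_le _ _
    _ ≤ |a| * (Kω * ‖X‖) + |b| * (Kq * Real.exp (4 * C₀) * ‖X‖
        + Kq * Real.exp (4 * C₀) * (4 * Kd) * ‖X‖) := by gcongr
    _ = (|a| * Kω + |b| * Kq * Real.exp (4 * C₀) * (1 + 4 * Kd)) * ‖X‖ := by ring

omit [CompleteSpace E] in
/-- **`|ΔΦ| ≤ A + |b| K_q e^{4C₀} · 4|Δf|`** for `Φ = a ω + b q e^{4f}`, with
`A = |a| K_ω + |b| K_q e^{4C₀} (16 C₁ + 1 + 8 K_s K_d)`, given `|Δω| ≤ K_ω`, `|q|, ‖dq‖, |Δq| ≤ K_q`,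
`|f| ≤ C₀`, `|∇f|² ≤ C₁`, `‖df‖ ≤ K_d`, `‖(G x)⁻¹‖ ≤ K_s` — the linear dependence on `Δf` that
replaces Chen's `|f_z|`-term of `c_sup`. [cite: Chen2005, Thm. 1 (the constant `c_sup`), §3] -/
theorem abs_lapAt_rhs_le (hi : (G x).IsInvertible) (hs : ∀ v w, G x v w = G x w v)
    (hω : ContDiffAt ℝ 2 wf x) (hq : ContDiffAt ℝ 2 q x) (hf : ContDiffAt ℝ 2 f x) (a b : ℝ)
    {Kω Kq C₀ C₁ Kd Ks : ℝ} (hKs : 0 ≤ Ks)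
    (hω2 : |lapAt G wf x| ≤ Kω) (hq0 : |q x| ≤ Kq) (hq1 : ‖fderiv ℝ q x‖ ≤ Kq)
    (hq2 : |lapAt G q x| ≤ Kq) (hf0 : |f x| ≤ C₀) (hγ : gradSqAt G f x ≤ C₁)
    (hγ0 : 0 ≤ gradSqAt G f x) (hDf : ‖fderiv ℝ f x‖ ≤ Kd) (hsh : ‖sharpAt G x‖ ≤ Ks) :
    |lapAt G (fun z ↦ a * wf z + b * (q z * Real.exp (4 * f z))) x| ≤
      (|a| * Kω + |b| * Kq * Real.exp (4 * C₀) * (16 * C₁ + 1 + 8 * Ks * Kd))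
        + |b| * Kq * Real.exp (4 * C₀) * 4 * |lapAt G f x| := by
  rw [lapAt_rhs hi hs hω hq hf a b]
  have hKq : 0 ≤ Kq := (abs_nonneg _).trans hq0
  have he0 : 0 < Real.exp (4 * f x) := Real.exp_pos _
  have he : Real.exp (4 * f x) ≤ Real.exp (4 * C₀) :=
    Real.exp_le_exp.2 (by linarith [(abs_le.1 hf0).2])
  set ψ := Real.exp (4 * f x) with hψ
  -- the three terms
  have t1 : |q x * (ψ * (4 * lapAt G f x + 16 * gradSqAt G f x))| ≤
      Kq * Real.exp (4 * C₀) * (4 * |lapAt G f x| + 16 * C₁) := by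
    rw [abs_mul, abs_mul, abs_of_pos he0]
    have h1 : |4 * lapAt G f x + 16 * gradSqAt G f x| ≤ 4 * |lapAt G f x| + 16 * C₁ := by
      refine (abs_add_le _ _).trans ?_
      rw [abs_mul, abs_mul, abs_of_pos (by norm_num : (0:ℝ) < 4), abs_of_pos (by norm_num : (0:ℝ) < 16),
        abs_of_nonneg hγ0]
      linarith
    calc |q x| * (ψ * |4 * lapAt G f x + 16 * gradSqAt G f x|)
        ≤ Kq * (Real.exp (4 * C₀) * (4 * |lapAt G f x| + 16 * C₁)) :=
          mul_le_mul hq0 (mul_le_mul he h1 (abs_nonneg _) (by positivity)) (by positivity) hKq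
      _ = _ := by ring
  have t2 : |ψ * lapAt G q x| ≤ Real.exp (4 * C₀) * Kq := by
    rw [abs_mul, abs_of_pos he0]
    exact mul_le_mul he hq2 (abs_nonneg _) (by positivity)
  have t3 : |2 * fderiv ℝ q x (sharpAt G x ((4 * ψ) • fderiv ℝ f x))| ≤
      8 * Real.exp (4 * C₀) * (Kq * Ks * Kd) := by
    rw [map_smul, map_smul, smul_eq_mul, abs_mul, abs_mul, abs_two, abs_mul,
      abs_of_pos (by norm_num : (0:ℝ) < 4), abs_of_pos he0]
    have h1 : |fderiv ℝ q x (sharpAt G x (fderiv ℝ f x))| ≤ Kq * Ks * Kd := by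
      rw [← Real.norm_eq_abs]
      calc ‖fderiv ℝ q x (sharpAt G x (fderiv ℝ f x))‖
          ≤ ‖fderiv ℝ q x‖ * ‖sharpAt G x (fderiv ℝ f x)‖ := (fderiv ℝ q x).le_opNorm _
        _ ≤ ‖fderiv ℝ q x‖ * (‖sharpAt G x‖ * ‖fderiv ℝ f x‖) := by
            gcongr; exact (sharpAt G x).le_opNorm _
        _ ≤ Kq * (Ks * Kd) := mul_le_mul hq1 (mul_le_mul hsh hDf (norm_nonneg _) hKs)
            (by positivity) hKq
        _ = Kq * Ks * Kd := by ring
    calc 2 * (4 * ψ * |fderiv ℝ q x (sharpAt G x (fderiv ℝ f x))|)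
        ≤ 2 * (4 * Real.exp (4 * C₀) * (Kq * Ks * Kd)) := by gcongr
      _ = _ := by ring
  have hb0 := abs_nonneg b
  calc |a * lapAt G wf x + b * (q x * (ψ * (4 * lapAt G f x + 16 * gradSqAt G f x))
        + ψ * lapAt G q x + 2 * fderiv ℝ q x (sharpAt G x ((4 * ψ) • fderiv ℝ f x)))|
      ≤ |a| * |lapAt G wf x| + |b| * (|q x * (ψ * (4 * lapAt G f x + 16 * gradSqAt G f x))|
        + |ψ * lapAt G q x| + |2 * fderiv ℝ q x (sharpAt G x ((4 * ψ) • fderiv ℝ f x))|) := by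
        refine (abs_add_le _ _).trans ?_
        rw [abs_mul, abs_mul]
        gcongr
        exact abs_add_three _ _ _
    _ ≤ |a| * Kω + |b| * (Kq * Real.exp (4 * C₀) * (4 * |lapAt G f x| + 16 * C₁)
        + Real.exp (4 * C₀) * Kq + 8 * Real.exp (4 * C₀) * (Kq * Ks * Kd)) := by gcongr
    _ = _ := by ring

end Rhs


/-! ### The algebra of the path equation in an orthonormal `4`-frame -/

set_option maxRecDepth 16384 in
/-- **The weighted path equation is `½(c (tr W)² − |W|²) = (1/16)|W_g|² + (q/4)e^{4u}` in a
frame.** With `H_{ab}, d_a, Ric_{ab}, R` the frame components of `Hess u, du, Ric, R` in a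
`g`-orthonormal `4`-frame (`Σ_a Ric_{aa} = R`), `W_{ab} = H_{ab} + d_a d_b − ½|d|²δ_{ab}
 + ½(Ric_{ab} − (R/6)δ_{ab})` and `c = 1 + 3(1−t)(2−t)`, the scalar identity
`q e^{4u} = σ₂(A)_frame − [2ΣRic H − RΣH_{aa}] + 2[(ΣH_{aa})² − ΣH² − ΣRic d d]
 − 2[(ΣH_{aa})|d|² + 2ΣH d d] − ¼ω + (1−t)(2−t)(R + 6ΣH_{aa} − 6|d|²)²/6`
(`GurskyViaclovskyPath.IsPathSolution.frame_identity` with `σ₂(A) = −½Σ(Ric − (R/4)δ)² + R²/24`)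
is equivalent to `½(c(Σ_a W_{aa})² − Σ_{ab} W_{ab}²) = ¼(q e^{4u} + ¼ω)`: a polynomial identity,
checked by `linear_combination` modulo `Σ Ric_{aa} = R`.
[cite: GurskyViaclovsky2003, §3 (path) and §1 (PDE)] [cite: ChangGurskyYang2003, §2, p. 121] -/
theorem sigma2Path_frame_algebra (H Ric : Fin 4 → Fin 4 → ℝ) (d : Fin 4 → ℝ) (R w t L : ℝ)
    (hS : ∑ a, Ric a a = R)
    (key : L =
      (-(1 / 2) * ∑ a, ∑ b, (Ric a b - R / 4 * (if a = b then 1 else 0)) ^ 2 + R ^ 2 / 24)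
      - (2 * ∑ a, ∑ b, Ric a b * H a b - R * ∑ a, H a a)
      + 2 * ((∑ a, H a a) ^ 2 - ∑ a, ∑ b, H a b ^ 2 - ∑ a, ∑ b, Ric a b * (d a * d b))
      - 2 * ((∑ a, H a a) * (∑ a, d a ^ 2) + 2 * ∑ a, ∑ b, H a b * (d a * d b))
      - 1 / 4 * w
      + (1 - t) * (2 - t) * (R + 6 * ∑ a, H a a - 6 * ∑ a, d a ^ 2) ^ 2 / 6) :
    1 / 2 * ((1 + 3 * ((1 - t) * (2 - t))) *
        (∑ a, (H a a + d a * d a - 1 / 2 * (∑ c, d c ^ 2) * (if a = a then 1 else 0)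
          + 1 / 2 * (Ric a a - R / 6 * (if a = a then 1 else 0)))) ^ 2
      - ∑ a, ∑ b, (H a b + d a * d b - 1 / 2 * (∑ c, d c ^ 2) * (if a = b then 1 else 0)
          + 1 / 2 * (Ric a b - R / 6 * (if a = b then 1 else 0))) ^ 2)
    = 1 / 4 * (L + 1 / 4 * w) := by
  simp only [Fin.sum_univ_four, Fin.isValue, Fin.reduceEq, if_true, if_false] at hS key ⊢
  rw [key]
  linear_combination ((1 + 3 * ((1 - t) * (2 - t))) / 4
      * (2 * (H 0 0 + H 1 1 + H 2 2 + H 3 3) - 2 * (d 0 ^ 2 + d 1 ^ 2 + d 2 ^ 2 + d 3 ^ 2)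
        + (Ric 0 0 + Ric 1 1 + Ric 2 2 + Ric 3 3) / 2 - R / 6)
    + (d 0 ^ 2 + d 1 ^ 2 + d 2 ^ 2 + d 3 ^ 2) / 4 - R / 48) * hS

end MetricCoord

end Literature.Geometry.Lorentzian

end
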